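import Summits.AtomisticToContinuum.Crystallization.Theorems.FreeSplittingCertificatesStrictSplittingRuleP1BareWeight

/-!
# `StrictSplittingRule` (stmt-AtomisticToContinuum-12560): the ledger's bare weights RE-CENTRED at any point `y₀` — weight facts and the two bare-demand transfers for the translated far-ledger field (P1 interpolant object, part 47)

Route `FreeSplittingCertificates`, crux r3 `StrictSplittingRule` (H12⋆ = `stub_coreJointCoercive`), unit b2b-freesplit-B gen 32.
VALUE = glue item G7 of the kernel assembly map for the ODD representative (HOME FAR-LEMMA-SPEC §23 (b), term (T7) at `p = (1,0,0)`): the far inequality of site `p`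
is stated for `ṽ(x) = v(y_p + x)` with the weight centred at `y_p`, so the hat-averaged far shares of the bare form use the weights `W(y − y_p)`.  Part 45 proved the weight
facts and the transfers for `y₀ = 0`; here, for ANY `y₀`:
* `continuous_radWeight_translate`, `continuous_credWeight_translate`, `continuous_bareMajorant_translate` (composition with `y ↦ y − y₀`);
* **`integrable_bareMajorant_growth_translate`** — `(c·χ(y−y₀)²·|y−y₀|⁻⁸)·(1+‖y‖)²` is integrable (`1+‖y‖ ≤ (1+‖y₀‖)(1+‖y−y₀‖)` + translation invariance);
* **`tsum_p1SiteBare_rad_le_p1DispSite_translate`** — `Σ'_q p1SiteBare[W_rad(·−y₀)](V)_q ≤ ∫ cχ(x)²s⁻⁵⟪x, v(y₀+x)⟫²dx + Σ'_T(∫_Tω(·−y₀))ρ_T|G_T(U)−A|²`;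
* **`integral_cred_le_tsum_p1SiteBare_p1DispSite_translate`** — `∫ c'χ(x)²s⁻⁴|v(y₀+x)|²dx ≤ Σ'_q p1SiteBare[W_cred(·−y₀)](V)_q`.
The right/left continuum sides are literally the radial-deficit and credit terms of `N_F2` for the translated field of `farPencil4_weighted_integral_le_p1Disp_translate`.
NOT a proof of H12⋆, NOT summit progress.  [folklore]
-/

noncomputable section

open Set Function Metric MeasureTheory Filter Topology
open scoped BigOperators NNReal ENNReal

namespace Summit.AtomisticToContinuum.Crystallization.Theorems.StrictSplittingRuleBirth

open Literature.MathematicalPhysics.StatisticalMechanics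
open Summit.AtomisticToContinuum.Crystallization.Theorems.PalmUnimodularRigidity.LayeredLawsSelectHcp

/-! ## Re-centred weight facts -/

/-- The re-centred radial weight is continuous. -/
theorem continuous_radWeight_translate {S1 S2 : ℝ} (hS1 : 0 < S1) (hS12 : S1 < S2) (c : ℝ) (y₀ : Fin 3 → ℝ) (k l : Fin 3) :
    Continuous fun y : Fin 3 → ℝ => c * fpChi S1 S2 (y - y₀) ^ 2 * (fpSq (y - y₀))⁻¹ ^ 5 * ((y - y₀) k * (y - y₀) l) :=
  ((continuous_radWeight hS1 hS12 c k l).comp (continuous_sub_right y₀)).congr fun _ => rfl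

/-- The re-centred credit weight is continuous. -/
theorem continuous_credWeight_translate {S1 S2 : ℝ} (hS1 : 0 < S1) (hS12 : S1 < S2) (c : ℝ) (y₀ : Fin 3 → ℝ) (k l : Fin 3) :
    Continuous fun y : Fin 3 → ℝ => c * fpChi S1 S2 (y - y₀) ^ 2 * (fpSq (y - y₀))⁻¹ ^ 4 * (if k = l then 1 else 0) :=
  ((continuous_credWeight hS1 hS12 c k l).comp (continuous_sub_right y₀)).congr fun _ => rfl

/-- The re-centred majorant is continuous. -/
theorem continuous_bareMajorant_translate {S1 S2 : ℝ} (hS1 : 0 < S1) (hS12 : S1 < S2) (c : ℝ) (y₀ : Fin 3 → ℝ) :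
    Continuous fun y : Fin 3 → ℝ => c * fpChi S1 S2 (y - y₀) ^ 2 * (fpSq (y - y₀))⁻¹ ^ 4 :=
  ((continuous_bareMajorant hS1 hS12 c).comp (continuous_sub_right y₀)).congr fun _ => rfl

/-- **The re-centred majorant against linear growth is integrable.** -/
theorem integrable_bareMajorant_growth_translate {S1 S2 : ℝ} (hS1 : 0 < S1) (hS12 : S1 < S2) (c : ℝ) (hc : 0 ≤ c) (y₀ : Fin 3 → ℝ) :
    Integrable fun y : Fin 3 → ℝ => (c * fpChi S1 S2 (y - y₀) ^ 2 * (fpSq (y - y₀))⁻¹ ^ 4) * (1 + ‖y‖) ^ 2 := by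
  have h0 := (integrable_bareMajorant_growth hS1 hS12 c).comp_sub_right y₀
  have hcont : Continuous fun y : Fin 3 → ℝ => (c * fpChi S1 S2 (y - y₀) ^ 2 * (fpSq (y - y₀))⁻¹ ^ 4) * (1 + ‖y‖) ^ 2 :=
    (continuous_bareMajorant_translate hS1 hS12 c y₀).mul ((continuous_const.add continuous_norm).pow 2)
  refine (h0.const_mul ((1 + ‖y₀‖) ^ 2)).mono' hcont.aestronglyMeasurable (Eventually.of_forall fun y => ?_)
  have hω : 0 ≤ c * fpChi S1 S2 (y - y₀) ^ 2 * (fpSq (y - y₀))⁻¹ ^ 4 := by have := fpSq_nonneg (y - y₀); positivity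
  rw [Real.norm_eq_abs, abs_of_nonneg (mul_nonneg hω (by positivity))]
  have h1 : 1 + ‖y‖ ≤ (1 + ‖y₀‖) * (1 + ‖y - y₀‖) := by
    have : ‖y‖ ≤ ‖y - y₀‖ + ‖y₀‖ := by
      calc ‖y‖ = ‖(y - y₀) + y₀‖ := by rw [sub_add_cancel]
        _ ≤ ‖y - y₀‖ + ‖y₀‖ := norm_add_le _ _
    nlinarith [norm_nonneg y₀, norm_nonneg (y - y₀)]
  have h2 : (1 + ‖y‖) ^ 2 ≤ (1 + ‖y₀‖) ^ 2 * (1 + ‖y - y₀‖) ^ 2 := by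
    rw [← mul_pow]; exact pow_le_pow_left₀ (by positivity) h1 2
  calc c * fpChi S1 S2 (y - y₀) ^ 2 * (fpSq (y - y₀))⁻¹ ^ 4 * (1 + ‖y‖) ^ 2
      ≤ c * fpChi S1 S2 (y - y₀) ^ 2 * (fpSq (y - y₀))⁻¹ ^ 4 * ((1 + ‖y₀‖) ^ 2 * (1 + ‖y - y₀‖) ^ 2) := mul_le_mul_of_nonneg_left h2 hω
    _ = (1 + ‖y₀‖) ^ 2 * (c * fpChi S1 S2 (y - y₀) ^ 2 * (fpSq (y - y₀))⁻¹ ^ 4 * (1 + ‖y - y₀‖) ^ 2) := by ring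

/-! ## The two bare-demand transfers for the translated field -/

/-- **RADIAL DEFICIT, re-centred at `y₀`**: for `c ≥ 0`, `0 < S₁ < S₂`, bounded radii with the vertex-distance property and `U` finitely supported,
`Σ'_q p1SiteBare[W_rad(· − y₀)](V)_q ≤ ∫ cχ(x)²s⁻⁵⟪x, p1Disp(y₀ + x)⟫²dx + Σ'_T (∫_T cχ(y−y₀)²|y−y₀|⁻⁸dy)·ρ_T·|G_T(U) − A|²_F`.
NOT a proof of H12⋆, NOT summit progress. -/
theorem tsum_p1SiteBare_rad_le_p1DispSite_translate {a h c S1 S2 : ℝ} (ha : 0 < a) (hh : 0 < h) (hc : 0 ≤ c) (hS1 : 0 < S1) (hS12 : S1 < S2)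
    (U : ℤ × ℤ × ℤ → (Fin 3 → ℝ)) (hU : (support U).Finite) (b₀ : Fin 3 → ℝ) (A : Fin 3 → Fin 3 → ℝ) (y₀ : Fin 3 → ℝ)
    (cT : (ℤ × ℤ × ℤ) × Fin 6 → Fin 3 → ℝ) (ρ : (ℤ × ℤ × ℤ) × Fin 6 → ℝ)
    (hρ : ∀ i, ∀ m : Fin 4, fpSq (fun k => hcpSite a h (i.1 + p1VertOff (p1Par i.1) i.2 m) k - cT i k) ≤ ρ i)
    {ρ₀ : ℝ} (hρ₀ : ∀ i, |ρ i| ≤ ρ₀) :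
    Summable (p1SiteBare a h (fun y k l => c * fpChi S1 S2 (y - y₀) ^ 2 * (fpSq (y - y₀))⁻¹ ^ 5 * ((y - y₀) k * (y - y₀) l))
      (fun n k => p1DispSite a h U b₀ A n k)) ∧
    ∑' q, p1SiteBare a h (fun y k l => c * fpChi S1 S2 (y - y₀) ^ 2 * (fpSq (y - y₀))⁻¹ ^ 5 * ((y - y₀) k * (y - y₀) l))
        (fun n k => p1DispSite a h U b₀ A n k) q ≤
      (∫ x, c * fpChi S1 S2 x ^ 2 * (fpSq x)⁻¹ ^ 5 * fpDot x (p1Disp a h U b₀ A (y₀ + x)) ^ 2) +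
        ∑' i, (∫ y in p1RealCell a h i, c * fpChi S1 S2 (y - y₀) ^ 2 * (fpSq (y - y₀))⁻¹ ^ 4) *
          (ρ i * fpFrob (fun j k => p1CellGrad a h U i j k - A j k)) := by
  have hmain := tsum_p1SiteBare_le_rad_p1DispSite ha hh
    (fun y k l => c * fpChi S1 S2 (y - y₀) ^ 2 * (fpSq (y - y₀))⁻¹ ^ 5 * ((y - y₀) k * (y - y₀) l))
    (continuous_radWeight_translate hS1 hS12 c y₀) (fun y u => p1Quad3_radWeight_nonneg hc S1 S2 (y - y₀) u)
    (continuous_bareMajorant_translate hS1 hS12 c y₀) (fun y u => p1Quad3_radWeight_le hc S1 S2 (y - y₀) u)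
    (integrable_bareMajorant_growth_translate hS1 hS12 c hc y₀) U hU b₀ A cT ρ hρ hρ₀
  have hint : (∫ y, p1Quad3 (fun k l => c * fpChi S1 S2 (y - y₀) ^ 2 * (fpSq (y - y₀))⁻¹ ^ 5 * ((y - y₀) k * (y - y₀) l))
      (p1Disp a h U b₀ A y)) = ∫ x, c * fpChi S1 S2 x ^ 2 * (fpSq x)⁻¹ ^ 5 * fpDot x (p1Disp a h U b₀ A (y₀ + x)) ^ 2 := by
    rw [← integral_add_left_eq_self (μ := volume)
      (fun y => p1Quad3 (fun k l => c * fpChi S1 S2 (y - y₀) ^ 2 * (fpSq (y - y₀))⁻¹ ^ 5 * ((y - y₀) k * (y - y₀) l))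
        (p1Disp a h U b₀ A y)) y₀]
    refine integral_congr_ae (Eventually.of_forall fun x => ?_)
    simp only [add_sub_cancel_left, p1Quad3_radWeight]
  rw [hint] at hmain
  exact hmain

/-- **CREDIT, re-centred at `y₀`** (Jensen direction): for `c ≥ 0`, `0 < S₁ < S₂`, `U` finitely supported,
`∫ cχ(x)²s⁻⁴|p1Disp(y₀ + x)|²dx ≤ Σ'_q p1SiteBare[W_cred(· − y₀)](V)_q` (summable).  NOT a proof of H12⋆, NOT summit progress. -/
theorem integral_cred_le_tsum_p1SiteBare_p1DispSite_translate {a h c S1 S2 : ℝ} (ha : 0 < a) (hh : 0 < h) (hc : 0 ≤ c)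
    (hS1 : 0 < S1) (hS12 : S1 < S2) (U : ℤ × ℤ × ℤ → (Fin 3 → ℝ)) (hU : (support U).Finite) (b₀ : Fin 3 → ℝ) (A : Fin 3 → Fin 3 → ℝ)
    (y₀ : Fin 3 → ℝ) :
    Summable (p1SiteBare a h (fun y k l => c * fpChi S1 S2 (y - y₀) ^ 2 * (fpSq (y - y₀))⁻¹ ^ 4 * (if k = l then 1 else 0))
      (fun n k => p1DispSite a h U b₀ A n k)) ∧
    (∫ x, c * fpChi S1 S2 x ^ 2 * (fpSq x)⁻¹ ^ 4 *
        (p1Disp a h U b₀ A (y₀ + x) 0 ^ 2 + p1Disp a h U b₀ A (y₀ + x) 1 ^ 2 + p1Disp a h U b₀ A (y₀ + x) 2 ^ 2)) ≤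
      ∑' q, p1SiteBare a h (fun y k l => c * fpChi S1 S2 (y - y₀) ^ 2 * (fpSq (y - y₀))⁻¹ ^ 4 * (if k = l then 1 else 0))
        (fun n k => p1DispSite a h U b₀ A n k) q := by
  set W : (Fin 3 → ℝ) → Fin 3 → Fin 3 → ℝ := fun y k l => c * fpChi S1 S2 (y - y₀) ^ 2 * (fpSq (y - y₀))⁻¹ ^ 4 * (if k = l then 1 else 0)
    with hW
  have hWc : ∀ k l, Continuous fun y => W y k l := continuous_credWeight_translate hS1 hS12 c y₀
  have hW0 : ∀ y u, 0 ≤ p1Quad3 (W y) u := fun y u => p1Quad3_credWeight_nonneg hc S1 S2 (y - y₀) u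
  have hWle : ∀ y u, p1Quad3 (W y) u ≤ (c * fpChi S1 S2 (y - y₀) ^ 2 * (fpSq (y - y₀))⁻¹ ^ 4) * (u 0 ^ 2 + u 1 ^ 2 + u 2 ^ 2) :=
    fun y u => p1Quad3_credWeight_le c S1 S2 (y - y₀) u
  have hωi := integrable_bareMajorant_growth_translate hS1 hS12 c hc y₀
  have hint := integrable_p1Quad3_p1Field_p1DispSite ha hh W hWc hW0 hWle hωi U hU b₀ A
  have hsum := summable_cellBare_p1DispSite ha hh W hWc hW0 hWle hωi U hU b₀ A
  have hmain := integral_quad_p1Field_le_tsum_p1SiteBare ha hh W hWc hW0 _ hint hsum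
  rw [← p1Disp_eq_p1Field ha.ne' hh.ne' U b₀ A] at hmain
  have hI : (∫ y, p1Quad3 (W y) (p1Disp a h U b₀ A y)) = ∫ x, c * fpChi S1 S2 x ^ 2 * (fpSq x)⁻¹ ^ 4 *
      (p1Disp a h U b₀ A (y₀ + x) 0 ^ 2 + p1Disp a h U b₀ A (y₀ + x) 1 ^ 2 + p1Disp a h U b₀ A (y₀ + x) 2 ^ 2) := by
    rw [← integral_add_left_eq_self (μ := volume) (fun y => p1Quad3 (W y) (p1Disp a h U b₀ A y)) y₀]
    refine integral_congr_ae (Eventually.of_forall fun x => ?_)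
    simp only [hW, add_sub_cancel_left, p1Quad3_credWeight]
  rw [hI] at hmain
  exact hmain

end Summit.AtomisticToContinuum.Crystallization.Theorems.StrictSplittingRuleBirth

end
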